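import Literature.NumberTheory.EllipticCurves.GoodReductionUnramifiedProofs
import Literature.NumberTheory.EllipticCurves.GeomPointsGaloisModule
import HarnessLib

/-!
# `E[p]` is unramified outside the bad places and the places above `p` — the exceptional set `S₀`
# of `stub_stepsTwoFourOdd` (skeleton v6 of crux 19276 `MuTransferX9`) in the `GaloisRep.IsUnramifiedAt`
# spelling of the local theory

Cell `b2b-bsdres` (X9 prover lineage, GEN 44) serving the K6 route `SmallImageMuTransfer` of cell
`bsd-smallim`. HONEST FRAMING: the cell deletes COMBINATION-SHAPED residual classes of the rank-≤1
BSD formula from PUBLISHED theorems only and TYPES the construction-shaped remainder; this is not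
"finishing BSD"; class X9 stays TYPED at class level. `--supports` helper toward the registered stub
`stub_stepsTwoFourOdd` of stmt-BirchSwinnertonDyer-19276; books nothing, closes nothing; theorems only
(no definition, no named fact).

The registered stub lets its prover choose a finite exceptional set `S₀` of places and then work at
`q ∉ S₁ ⊇ S₀`; the local theory at `q` (koly `…X9LocalSplitPrime`, x10 `…X9StepFour*`, x9
`…X9StepsTwoFourPairTransport`) wants `hur : GaloisRep.IsUnramifiedAt q (W.torsionGaloisModule p)` and
`hSp : (p : 𝓞 K) ∉ q.asIdeal`.  The tree proves the inertia statement at good places `v ∤ n` in the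
`galoisRepTorsion` / `geomTorsion` spellings (`galoisRepTorsion_eq_one_of_mem_inertia`,
`smul_geomTorsion_eq_of_mem_inertia`, Silverman VII.4.1 (a)) and the finiteness of the bad places
(`finite_badPlaces_holds`, `eventually_hasGoodReductionAt`); this file restates them in the
`DiscreteGaloisModule` currency and packages the supply of `S₀`:

* `isUnramifiedAt_torsionGaloisModule_of_hasGoodReductionAt` — `E[n]` is unramified at a good `v ∤ n`;
* `isUnramifiedOutside_torsionGaloisModule` — outside `badPlaces ∪ {v ∣ n}`;
* `exists_finite_isUnramifiedAt_torsionGaloisModule` — a finite `S₀` with, for every `v ∉ S₀`: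
  `(p : 𝓞 K) ∉ v.asIdeal`, `W.HasGoodReductionAt v`, `GaloisRep.IsUnramifiedAt v (W.torsionGaloisModule p)`.

PARTITION (D-0054): X9 (A4) · X10∧¬Surj (A5) at `p = 3` (prime-generic, any number field) —
hypothesis-discharging helper toward `stub_stepsTwoFourOdd`; closes NONE.

References: J. H. Silverman, *The Arithmetic of Elliptic Curves*, Prop. VII.4.1 (a), Rem. VIII.1.3
[SilvermanAEC2009]; J.-P. Serre, *Abelian ℓ-adic representations* (1968), IV.1.2–1.3 [SerreAbelianLadic1968].
-/

-- the summit and its single problem are both named `BirchSwinnertonDyer` (registry layout D-0017)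
set_option linter.dupNamespace false

set_option autoImplicit false

noncomputable section

open scoped NumberField
open Field WeierstrassCurve Literature.NumberTheory.EllipticCurves
  Literature.NumberTheory.GaloisRepresentations Function IsDedekindDomain NumberField

universe u

namespace Summit.BirchSwinnertonDyer.BirchSwinnertonDyer.Rank1Residual.TorsionUnramified

variable {K : Type u} [Field K] [NumberField K] (W : WeierstrassCurve K) [W.IsElliptic]

/-- **`E[n]` is unramified at a place `v ∤ n` of good reduction** (Silverman VII.4.1 (a)), in the
`GaloisRep.IsUnramifiedAt` spelling of the `DiscreteGaloisModule` `W.torsionGaloisModule n` (the tree's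
`smul_geomTorsion_eq_of_mem_inertia`). [cite: SilvermanAEC2009, Prop. VII.4.1(a)] -/
theorem isUnramifiedAt_torsionGaloisModule_of_hasGoodReductionAt {v : HeightOneSpectrum (𝓞 K)}
    (hv : W.HasGoodReductionAt v) {n : ℤ} (hn : (n : 𝓞 K) ∉ v.asIdeal) :
    GaloisRep.IsUnramifiedAt v (W.torsionGaloisModule n) := by
  intro 𝔓 h𝔓 τ hτ
  refine LinearMap.ext fun P => ?_
  rw [torsionGaloisModule_apply_apply]
  exact W.smul_geomTorsion_eq_of_mem_inertia hv hn h𝔓 hτ P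

/-- The same for a natural number `p` (the hypothesis `(p : 𝓞 K) ∉ v.asIdeal` with `p : ℕ`, as in the
local theory's `hqp`/`hSp`). [cite: SilvermanAEC2009, Prop. VII.4.1(a)] -/
theorem isUnramifiedAt_torsionGaloisModule_natCast_of_hasGoodReductionAt {v : HeightOneSpectrum (𝓞 K)}
    (hv : W.HasGoodReductionAt v) {p : ℕ} (hp : ((p : ℕ) : 𝓞 K) ∉ v.asIdeal) :
    GaloisRep.IsUnramifiedAt v (W.torsionGaloisModule (p : ℤ)) :=
  isUnramifiedAt_torsionGaloisModule_of_hasGoodReductionAt W hv (by exact_mod_cast hp)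

/-- **`E[p]` is unramified outside the bad places and the places above `p`.**
[cite: SilvermanAEC2009, Prop. VII.4.1(a)] -/
theorem isUnramifiedOutside_torsionGaloisModule (p : ℕ) :
    (W.torsionGaloisModule (p : ℤ)).IsUnramifiedOutside
      (W.badPlaces (𝓞 K) ∪ {v | ((p : ℕ) : 𝓞 K) ∈ v.asIdeal}) := by
  intro v hv
  simp only [Set.mem_union, mem_badPlaces_iff, Set.mem_setOf_eq, not_or, not_not] at hv
  exact isUnramifiedAt_torsionGaloisModule_natCast_of_hasGoodReductionAt W hv.1 hv.2

/-- **Supply of the exceptional set `S₀`**: for `p ≠ 0` there is a FINITE set of finite places of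
`K` outside which `v ∤ p`, `E` has good reduction at `v`, and `E[p]` is unramified at `v`
(`finite_badPlaces_holds` + finitely many places above `p`). [cite: SilvermanAEC2009, Prop. VII.4.1(a) with Rem. VIII.1.3] -/
theorem exists_finite_isUnramifiedAt_torsionGaloisModule {p : ℕ} (hp : p ≠ 0) :
    ∃ S₀ : Set (HeightOneSpectrum (𝓞 K)), S₀.Finite ∧ ∀ v ∉ S₀,
      ((p : ℕ) : 𝓞 K) ∉ v.asIdeal ∧ W.HasGoodReductionAt v ∧
        GaloisRep.IsUnramifiedAt v (W.torsionGaloisModule (p : ℤ)) := by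
  refine ⟨W.badPlaces (𝓞 K) ∪ {v | ((p : ℕ) : 𝓞 K) ∈ v.asIdeal},
    (W.finite_badPlaces_holds (𝓞 K)).union
      (IsDedekindDomain.HeightOneSpectrum.finite_setOf_natCast_mem hp),
    fun v hv => ?_⟩
  have hv' := hv
  simp only [Set.mem_union, mem_badPlaces_iff, Set.mem_setOf_eq, not_or, not_not] at hv'
  exact ⟨hv'.2, hv'.1, isUnramifiedOutside_torsionGaloisModule W p v hv⟩

/-- The same with a prescribed finite set `T` absorbed (e.g. the exceptional primes of an Euler
system, or the `S₀` of another clause): a finite `S₀ ⊇ T` with the three properties off `S₀`.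
[cite: SilvermanAEC2009, Prop. VII.4.1(a) with Rem. VIII.1.3] -/
theorem exists_finite_superset_isUnramifiedAt_torsionGaloisModule {p : ℕ} (hp : p ≠ 0)
    {T : Set (HeightOneSpectrum (𝓞 K))} (hT : T.Finite) :
    ∃ S₀ : Set (HeightOneSpectrum (𝓞 K)), S₀.Finite ∧ T ⊆ S₀ ∧ ∀ v ∉ S₀,
      ((p : ℕ) : 𝓞 K) ∉ v.asIdeal ∧ W.HasGoodReductionAt v ∧
        GaloisRep.IsUnramifiedAt v (W.torsionGaloisModule (p : ℤ)) := by
  obtain ⟨S₀, hS₀, h⟩ := exists_finite_isUnramifiedAt_torsionGaloisModule W hp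
  exact ⟨S₀ ∪ T, hS₀.union hT, Set.subset_union_right, fun v hv =>
    h v fun hv' => hv (Set.mem_union_left T hv')⟩

end Summit.BirchSwinnertonDyer.BirchSwinnertonDyer.Rank1Residual.TorsionUnramified

end
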